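import Mathlib
import Summits.Ventures.PercRepro2.TB14Deg2Mark

/-!
# The degree-two mark identity for the mark `o` (the mirror of Theorem N)
(blind cell PercRepro2, mine-c g18, 2026-08-25; `proofs/MINEC-TB14BLOCK.md` §12.1)

The (TB14) slack is invariant under the relabelling `(a₁, a₂, b, o) ↦ (a₂, a₁, o, b)`
(`tb14_slack_relabel`, through `slack_eq_pairCount_foldK`), so Theorem N applied to the relabelled
instance gives the three-term identity for a mark `o` with exactly two free edges `o u`, `o v`:
`D(G; b, o) = D(G − o; b, u) + D(G − o; b, v) + T′`, where `T′` is the count of the star kernel of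
the relabelled instance (the folded kernel of the mark `u` for the roots `(a₂, a₁)` on the rerouted
graph `ends[e₁ ↦ s(u, v)]`, with `e₁` open in the first copy only).  Own work; standard axioms.
-/

namespace Summit.Ventures.PercRepro2

namespace TB14Cut

open CovForm A3InactiveTyped

section Deg2MarkMirror

variable {V : Type} {E : Type} [Fintype E] [DecidableEq E] {R : Type*} [Field R]
variable {ends : E → Sym2 V} {e₁ e₂ : E} {o u v a₁ a₂ b : V}

/-- The two-copy counts of the folded kernels of an instance and of its relabelling agree. -/
lemma pairCount_foldK_relabel (F : Finset E) (z : Config E) :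
    pairCount F z (foldK ends a₂ a₁ o b : Config E → Config E → R) =
      pairCount F z (foldK ends a₁ a₂ b o) := by
  classical
  have h1 := slack_eq_pairCount_foldK (R := R) ends a₁ a₂ b o F z
  have h2 := slack_eq_pairCount_foldK (R := R) ends a₂ a₁ o b F z
  have h3 := tb14_slack_relabel (R := R) ends a₁ a₂ b o F z
  rw [← h2, h3, h1]

/-- **Theorem N for the mark `o`** (the mirror): if `o` has exactly the two free edges `e₁ = o u`
and `e₂ = o v`, then `D(G; b, o) = D(G − o; b, u) + D(G − o; b, v) + T′`. -/
theorem pairCount_foldK_deg2mark_o (he : e₁ ≠ e₂) (h₁ : ends e₁ = s(o, u)) (h₂ : ends e₂ = s(o, v))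
    (hou : o ≠ u) (hov : o ≠ v) (ho : ∀ f, o ∈ ends f → f = e₁ ∨ f = e₂)
    (ha₁ : a₁ ≠ o) (ha₂ : a₂ ≠ o) (hb : b ≠ o) (F : Finset E) (z : Config E) (h₁F : e₁ ∈ F)
    (h₂F : e₂ ∈ F) :
    pairCount F z (foldK ends a₁ a₂ b o : Config E → Config E → R) =
      pairCount ((F.erase e₂).erase e₁) (Function.update (Function.update z e₂ false) e₁ false)
          (foldK ends a₁ a₂ b u) +
        pairCount ((F.erase e₂).erase e₁) (Function.update (Function.update z e₂ false) e₁ false)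
          (foldK ends a₁ a₂ b v) +
        pairCount ((F.erase e₂).erase e₁) (Function.update (Function.update z e₂ false) e₁ false)
          (fun y₂ w₂ => foldK (Function.update ends e₁ s(u, v)) a₂ a₁ u b
            (Function.update y₂ e₁ true) w₂) := by
  classical
  rw [← pairCount_foldK_relabel (R := R) (ends := ends) (a₁ := a₁) (a₂ := a₂) (b := b) (o := o),
    pairCount_foldK_deg2mark he h₁ h₂ hou hov ho ha₂ ha₁ hb F z h₁F h₂F,
    pairCount_foldK_relabel (R := R) (ends := ends) (a₁ := a₁) (a₂ := a₂) (b := b) (o := u),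
    pairCount_foldK_relabel (R := R) (ends := ends) (a₁ := a₁) (a₂ := a₂) (b := b) (o := v)]

end Deg2MarkMirror

end TB14Cut

end Summit.Ventures.PercRepro2
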